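import Summits.QuantumFields.YangMills.Theorems.CovariantDischargeLatticeRieszL2
import Literature.Probability.LatticeModels.LatticeGreenPoisson
import Literature.MathematicalPhysics.QuantumFieldTheory.Balaban1983to89.B4Eq19LatticeOperators
import HarnessLib

/-!
# Line «sandwich_discharge» on crux `HistoryTailL` (stmt-QuantumFields-19936), stub `stub_sandwichSweepGapCapped` (S′), brick B5 on `ℤ^d` —
# (Z-e) FILE 2 «THE GREEN POTENTIAL `β := G₀ ∗ ω`: THE POISSON EQUATION, AND THE `j`-UNIFORM ℓ² BOUND FOR THE CURL OF ITS CODIFFERENTIAL»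

Cell `ym3-torus` (YM ladder rung R3 = continuum SU(2) Yang–Mills on the three-torus — a RUNG, NOT the Clay problem: not d = 4, not infinite volume,
not a mass gap); width seat `ym3-torus-px8` gen 7; `--supports stmt-QuantumFields-19936` (helper).  THEOREMS ONLY (0 `def`, default heartbeats); generic
`d ≥ 3`; the letters of ✓(Z-a) `CovariantDischargeLatticeFormsDeg23` (px6 g8) and FILE 1 `CovariantDischargeTruncatedPotentialPairing` (free symbols
pinned by pointwise hypotheses), over lit ✓`LatticeGreenPoisson` (`(−Δ)(G∕2) = δ₀` on `ℤ^d`, `d ≥ 3`) and ✓p714344 (Z-d) `CovariantDischargeLatticeRieszL2`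
(w8 g8: the discrete second Riesz transforms are `ℓ²`-bounded).

THE OBJECTS.  `ω : ℤ^d → 2-forms` supported in `box p ℓ`; `β(x,μ,ν) := Σ_{y ∈ box p ℓ} (G(x − y)∕2)·ω(y,μ,ν)` (`G = latticeGreen`); `γ := d₂β` (alternating).
* §1 `negLaplacian_halfGreen` (`Σ_κ (2G₀ z − G₀(z+e_κ) − G₀(z−e_κ)) = [z = 0]`, the lit Poisson equation in the `−Δ` letter of (Z-a)) and
  ★★`poisson_of_halfGreen_conv`: `ω(x,μ,ν) = Σ_κ (2β(x) − β(x+e_κ) − β(x−e_κ))(μ,ν)` on ALL of `ℤ^d` — FILE 1's hypothesis `hΔ` DISCHARGED.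
* §2 ★`dTwo_bdiff_eq` (pointwise): `γ(x−e_κ,κ,μ,ν) − γ(x,κ,μ,ν) = −T_{κκ}^{μν}(x) + T_{κμ}^{κν}(x) − T_{κν}^{κμ}(x)` with the MIXED SECOND DIFFERENCE
  `T_{κa}^{c}(x) := ∇⁺_aβ_c(x) − ∇⁺_aβ_c(x − e_κ) = Σ_y ω_c(y)·(G(x−e_κ−y+e_κ+e_a) − G(x−e_κ−y+e_κ) − G(x−e_κ−y+e_a) + G(x−e_κ−y))∕2` — EXACTLY (Z-d)'s kernel at the
  shifted site `x − e_κ`; ★`sum_sq_mixedDiff_le`: `Σ_{x∈B} T_{κa}^{c}(x)² ≤ Σ_{y∈box p ℓ} ω_c(y)²` for EVERY finite `B` ((Z-d) by name after the shift `x ↦ x − e_κ`).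
* §3 ★★★`sum_sq_curl_potential_le` — **THE `j`-UNIFORM ℓ² ROW**: for every finite `B ⊆ ℤ^d`,
  `Σ_{x∈B} Σ_{μν} (ω(x,μ,ν) − (δ₃γ)(x,μ,ν))² ≤ (2 + 18d²)·Σ_{y ∈ box p ℓ} Σ_{μν} ω(y,μ,ν)²`
  (`ω − δ₃γ = d₁δ₂β` by (Z-a) `curl_deltaTwo_eq` + §1; `= ω + Σ_κ(T_{κκ}^{μν} − T_{κμ}^{κν} + T_{κν}^{κμ})`, Cauchy–Schwarz over the `1 + 3d` terms, §2 termwise).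
  With FILE 1 `sum_sq_curl_truncated_le` this is the COST row `Σ(d₁a_R)² ≤ 2(2+18d²)‖ω‖₂² + 4ρ²·Σ(a² + a²)` of ARCH-S′ §6 ∕ w8 LOCATE §5 (`A₂` `j`-uniform).
Text-independent of the stub; restates no stub.  HONEST SCOPE: finite sums + one landed Fourier theorem by name; NOTHING here proves B5, the capped stub,
`HistoryTailL`, or any summit statement; YM₃ on T³ is rung R3, not Clay. [folklore] (Poisson: Lawler 1991 §1.5 — lit, cited there).
-/

noncomputable section

open scoped BigOperators
open Finset

namespace Summit.QuantumFields.YangMills.Theorems.CovariantDischargeGreenPotentialL2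

open Literature.Probability.LatticeModels (latticeGreen latticeLaplacianZd latticeLaplacianZd_half_latticeGreen)
open Literature.MathematicalPhysics.QuantumFieldTheory.Balaban1983to89.B4Eq19LatticeOperators
open Summit.QuantumFields.YangMills.Theorems.CovariantDischargeLatticeRieszL2 (sum_sq_secondDiff_latticeGreen_conv_le)

variable {d : ℕ}

/-! ## §1 The Poisson equation for `β := G₀ ∗ ω` -/

/-- ★ **`(−Δ)G₀ = δ₀`** in the letter `Σ_κ (2u(z) − u(z+e_κ) − u(z−e_κ))` of (Z-a), `G₀ := latticeGreen∕2`, `d ≥ 3`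
(lit ✓`latticeLaplacianZd_half_latticeGreen`). [cite: Lawler1991, §1.5, p. 29] -/
theorem negLaplacian_halfGreen (hd : 3 ≤ d) (z : Zd d) :
    ∑ κ, (2 * (latticeGreen z / 2) - latticeGreen (z + unitVec κ) / 2 - latticeGreen (z - unitVec κ) / 2) = if z = 0 then 1 else 0 := by
  have h := latticeLaplacianZd_half_latticeGreen d hd z
  simp only [latticeLaplacianZd] at h
  have hsum : ∑ κ, (2 * (latticeGreen z / 2) - latticeGreen (z + unitVec κ) / 2 - latticeGreen (z - unitVec κ) / 2)
      = 2 * (d : ℝ) * (latticeGreen z / 2)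
        - ∑ i : Fin d, (latticeGreen (z + Pi.single i 1) / 2 + latticeGreen (z - Pi.single i 1) / 2) := by
    have hu : ∀ μ : Fin d, (unitVec μ : Zd d) = Pi.single μ 1 := fun _ => rfl
    simp only [hu, Finset.sum_sub_distrib, Finset.sum_add_distrib, Finset.sum_const, Finset.card_univ, Fintype.card_fin,
      nsmul_eq_mul]
    ring
  rw [hsum]
  linarith

/-- The convolution sum swapped with the stencil sum (bookkeeping). [folklore] -/
theorem sum_stencil_conv_eq (ωc : Zd d → ℝ) (S : Finset (Zd d)) (x : Zd d) :
    ∑ κ, (2 * ∑ y ∈ S, latticeGreen (x - y) / 2 * ωc y - ∑ y ∈ S, latticeGreen (x + unitVec κ - y) / 2 * ωc y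
        - ∑ y ∈ S, latticeGreen (x - unitVec κ - y) / 2 * ωc y)
      = ∑ y ∈ S, (∑ κ, (2 * (latticeGreen (x - y) / 2) - latticeGreen ((x - y) + unitVec κ) / 2 - latticeGreen ((x - y) - unitVec κ) / 2)) * ωc y := by
  simp only [Finset.mul_sum, ← Finset.sum_sub_distrib, Finset.sum_mul]
  rw [Finset.sum_comm]
  refine Finset.sum_congr rfl fun y _ => Finset.sum_congr rfl fun κ _ => ?_
  rw [add_sub_right_comm x (unitVec κ) y, sub_right_comm x (unitVec κ) y]
  ring

/-- ★★ **THE POISSON EQUATION FOR THE GREEN POTENTIAL** (FILE 1's `hΔ` discharged): if `ω` vanishes off `box p ℓ` and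
`β(x,μ,ν) = Σ_{y∈box p ℓ} (G(x−y)∕2)·ω(y,μ,ν)`, then `ω(x,μ,ν) = Σ_κ (2β(x,μ,ν) − β(x+e_κ,μ,ν) − β(x−e_κ,μ,ν))` for EVERY `x ∈ ℤ^d`. [folklore] -/
theorem poisson_of_halfGreen_conv (hd : 3 ≤ d) (ω β : Zd d → Fin d → Fin d → ℝ) (p : Zd d) (ℓ : ℤ)
    (hω0 : ∀ x, x ∉ box p ℓ → ∀ μ ν, ω x μ ν = 0)
    (hβ : ∀ x μ ν, β x μ ν = ∑ y ∈ box p ℓ, latticeGreen (x - y) / 2 * ω y μ ν) (x : Zd d) (μ ν : Fin d) :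
    ω x μ ν = ∑ κ, (2 * β x μ ν - β (x + unitVec κ) μ ν - β (x - unitVec κ) μ ν) := by
  simp only [hβ]
  rw [sum_stencil_conv_eq (fun y => ω y μ ν) (box p ℓ) x]
  simp only [negLaplacian_halfGreen hd, sub_eq_zero, ite_mul, one_mul, zero_mul]
  rw [Finset.sum_ite_eq]
  by_cases hx : x ∈ box p ℓ
  · rw [if_pos hx]
  · rw [if_neg hx, hω0 x hx μ ν]

/-! ## §2 The mixed second differences of `β` and their ℓ² bound -/

/-- ★ **THE BACKWARD STEP OF `γ = d₂β` IN MIXED SECOND DIFFERENCES** (pointwise, any 2-form `β`): with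
`T x κ a c₁ c₂ := (β(x+e_a) − β(x) − β(x−e_κ+e_a) + β(x−e_κ))(c₁,c₂)`,
`γ(x−e_κ,κ,μ,ν) − γ(x,κ,μ,ν) = −T x κ κ μ ν + T x κ μ κ ν − T x κ ν κ μ`. [folklore] -/
theorem dTwo_bdiff_eq (β : Zd d → Fin d → Fin d → ℝ) (γ : Zd d → Fin d → Fin d → Fin d → ℝ) (T : Zd d → Fin d → Fin d → Fin d → Fin d → ℝ)
    (hγ : ∀ x κ μ ν, γ x κ μ ν = (β (x + unitVec κ) μ ν - β x μ ν) - (β (x + unitVec μ) κ ν - β x κ ν) + (β (x + unitVec ν) κ μ - β x κ μ))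
    (hT : ∀ x κ a c₁ c₂, T x κ a c₁ c₂ = β (x + unitVec a) c₁ c₂ - β x c₁ c₂ - β (x - unitVec κ + unitVec a) c₁ c₂ + β (x - unitVec κ) c₁ c₂)
    (x : Zd d) (κ μ ν : Fin d) :
    γ (x - unitVec κ) κ μ ν - γ x κ μ ν = -T x κ κ μ ν + T x κ μ κ ν - T x κ ν κ μ := by
  simp only [hγ, hT, sub_add_cancel]
  ring

/-- The mixed second difference of the Green potential is (Z-d)'s kernel at the shifted site: with `β = (G∕2) ∗ ω_c`,
`T x κ a c = Σ_y ω_c(y)·(G(x' − y + e_κ + e_a) − G(x' − y + e_κ) − G(x' − y + e_a) + G(x' − y))∕2`, `x' := x − e_κ`. [folklore] -/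
theorem mixedDiff_eq_conv (ω β : Zd d → Fin d → Fin d → ℝ) (T : Zd d → Fin d → Fin d → Fin d → Fin d → ℝ) (p : Zd d) (ℓ : ℤ)
    (hβ : ∀ x μ ν, β x μ ν = ∑ y ∈ box p ℓ, latticeGreen (x - y) / 2 * ω y μ ν)
    (hT : ∀ x κ a c₁ c₂, T x κ a c₁ c₂ = β (x + unitVec a) c₁ c₂ - β x c₁ c₂ - β (x - unitVec κ + unitVec a) c₁ c₂ + β (x - unitVec κ) c₁ c₂)
    (x : Zd d) (κ a c₁ c₂ : Fin d) :
    T x κ a c₁ c₂ = (1 / 2) * ∑ y ∈ box p ℓ, ω y c₁ c₂ *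
        (latticeGreen ((x - unitVec κ) - y + Pi.single κ 1 + Pi.single a 1) - latticeGreen ((x - unitVec κ) - y + Pi.single κ 1)
          - latticeGreen ((x - unitVec κ) - y + Pi.single a 1) + latticeGreen ((x - unitVec κ) - y)) := by
  rw [hT, hβ, hβ, hβ, hβ, Finset.mul_sum, ← Finset.sum_sub_distrib, ← Finset.sum_sub_distrib, ← Finset.sum_add_distrib]
  refine Finset.sum_congr rfl fun y _ => ?_
  have hu : ∀ μ : Fin d, (unitVec μ : Zd d) = Pi.single μ 1 := fun _ => rfl
  have e1 : x + unitVec a - y = x - unitVec κ - y + Pi.single κ 1 + Pi.single a 1 := by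
    rw [← hu κ, ← hu a]; abel
  have e2 : x - y = x - unitVec κ - y + Pi.single κ 1 := by rw [← hu κ]; abel
  have e3 : x - unitVec κ + unitVec a - y = x - unitVec κ - y + Pi.single a 1 := by rw [← hu a]; abel
  rw [e1, e2, e3]
  ring

/-- ★ **THE ℓ² BOUND OF ONE MIXED SECOND DIFFERENCE** over any finite set of sites: `Σ_{x∈B} (T x κ a c)² ≤ Σ_{y∈box p ℓ} ω_c(y)²`
((Z-d) ✓`sum_sq_secondDiff_latticeGreen_conv_le` after the shift `x ↦ x − e_κ`; the `4` there against the `(1∕2)²` here). [folklore] -/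
theorem sum_sq_mixedDiff_le (hd : 3 ≤ d) (ω β : Zd d → Fin d → Fin d → ℝ) (T : Zd d → Fin d → Fin d → Fin d → Fin d → ℝ) (p : Zd d) (ℓ : ℤ)
    (hβ : ∀ x μ ν, β x μ ν = ∑ y ∈ box p ℓ, latticeGreen (x - y) / 2 * ω y μ ν)
    (hT : ∀ x κ a c₁ c₂, T x κ a c₁ c₂ = β (x + unitVec a) c₁ c₂ - β x c₁ c₂ - β (x - unitVec κ + unitVec a) c₁ c₂ + β (x - unitVec κ) c₁ c₂)
    (B : Finset (Zd d)) (κ a c₁ c₂ : Fin d) :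
    ∑ x ∈ B, T x κ a c₁ c₂ ^ 2 ≤ ∑ y ∈ box p ℓ, ω y c₁ c₂ ^ 2 := by
  classical
  -- shift the summation set
  have hinj : Set.InjOn (fun x : Zd d => x - unitVec κ) ↑B := fun x _ x' _ h => sub_left_injective h
  have hZ := sum_sq_secondDiff_latticeGreen_conv_le hd κ a (box p ℓ) (B.image fun x => x - unitVec κ) (fun y => ω y c₁ c₂)
  rw [Finset.sum_image hinj] at hZ
  have hpt : ∀ x ∈ B, T x κ a c₁ c₂ ^ 2 = (1 / 4) * (∑ y ∈ box p ℓ, ω y c₁ c₂ *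
      (latticeGreen ((x - unitVec κ) - y + Pi.single κ 1 + Pi.single a 1) - latticeGreen ((x - unitVec κ) - y + Pi.single κ 1)
        - latticeGreen ((x - unitVec κ) - y + Pi.single a 1) + latticeGreen ((x - unitVec κ) - y))) ^ 2 := by
    intro x _
    rw [mixedDiff_eq_conv ω β T p ℓ hβ hT x κ a c₁ c₂]
    ring
  rw [Finset.sum_congr rfl hpt, ← Finset.mul_sum]
  linarith

/-! ## §3 The `j`-uniform ℓ² row for `d₁δ₂β = ω − δ₃d₂β` -/

/-- Cauchy–Schwarz over `Fin d`: `(Σ_κ u κ)² ≤ d·Σ_κ (u κ)²`. [folklore] -/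
theorem sq_sum_fin_le (u : Fin d → ℝ) : (∑ κ, u κ) ^ 2 ≤ (d : ℝ) * ∑ κ, u κ ^ 2 := by
  have h := sq_sum_le_card_mul_sum_sq (s := (Finset.univ : Finset (Fin d))) (f := u)
  simpa using h

/-- Pointwise: `(ω + Σ_κ (A_κ − B_κ + C_κ))² ≤ 2ω² + 6d·Σ_κ (A_κ² + B_κ² + C_κ²)`. [folklore] -/
theorem sq_add_sum_three_le (w : ℝ) (A B C : Fin d → ℝ) :
    (w + ∑ κ, (A κ - B κ + C κ)) ^ 2 ≤ 2 * w ^ 2 + 6 * (d : ℝ) * ∑ κ, (A κ ^ 2 + B κ ^ 2 + C κ ^ 2) := by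
  have h1 : (w + ∑ κ, (A κ - B κ + C κ)) ^ 2 ≤ 2 * w ^ 2 + 2 * (∑ κ, (A κ - B κ + C κ)) ^ 2 := by
    nlinarith [sq_nonneg (w - ∑ κ, (A κ - B κ + C κ))]
  have h2 := sq_sum_fin_le (fun κ => A κ - B κ + C κ)
  have h3 : ∑ κ, (A κ - B κ + C κ) ^ 2 ≤ ∑ κ, 3 * (A κ ^ 2 + B κ ^ 2 + C κ ^ 2) :=
    Finset.sum_le_sum fun κ _ => by nlinarith [sq_nonneg (A κ + B κ), sq_nonneg (A κ - C κ), sq_nonneg (B κ + C κ)]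
  rw [← Finset.mul_sum] at h3
  have hd0 : (0 : ℝ) ≤ d := Nat.cast_nonneg d
  nlinarith

/-- The charge's own ℓ² mass over any `B` is at most its total mass (it vanishes off `box p ℓ`). [folklore] -/
theorem sum_sq_charge_le (ω : Zd d → Fin d → Fin d → ℝ) (p : Zd d) (ℓ : ℤ) (hω0 : ∀ x, x ∉ box p ℓ → ∀ μ ν, ω x μ ν = 0)
    (B : Finset (Zd d)) (μ ν : Fin d) : ∑ x ∈ B, ω x μ ν ^ 2 ≤ ∑ y ∈ box p ℓ, ω y μ ν ^ 2 := by
  classical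
  have h1 : ∑ x ∈ B, ω x μ ν ^ 2 = ∑ x ∈ B ∩ box p ℓ, ω x μ ν ^ 2 := by
    refine (Finset.sum_subset Finset.inter_subset_left fun x hxB hx => ?_).symm
    rw [Finset.mem_inter, not_and] at hx
    rw [hω0 x (hx hxB) μ ν]; ring
  rw [h1]
  exact Finset.sum_le_sum_of_subset_of_nonneg Finset.inter_subset_right fun x _ _ => sq_nonneg _

/-- ★★★ **THE `j`-UNIFORM ℓ² ROW.**  For `ω` vanishing off `box p ℓ`, `β := (G∕2) ∗ ω` componentwise and `γ := d₂β` (alternating), for EVERY finite `B ⊆ ℤ^d`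
(`d ≥ 3`): `Σ_{x∈B} Σ_{μν} (ω(x,μ,ν) − Σ_κ(γ(x−e_κ,κ,μ,ν) − γ(x,κ,μ,ν)))² ≤ (2 + 18d²)·Σ_{y∈box p ℓ} Σ_{μν} ω(y,μ,ν)²` — uniformly in `B`, `p`, `ℓ` and
the supports: the COST constant of the capped sweep is `j`-uniform. [folklore] -/
theorem sum_sq_curl_potential_le (hd : 3 ≤ d) (ω β : Zd d → Fin d → Fin d → ℝ) (γ : Zd d → Fin d → Fin d → Fin d → ℝ) (p : Zd d) (ℓ : ℤ)
    (hω0 : ∀ x, x ∉ box p ℓ → ∀ μ ν, ω x μ ν = 0)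
    (hβ : ∀ x μ ν, β x μ ν = ∑ y ∈ box p ℓ, latticeGreen (x - y) / 2 * ω y μ ν)
    (hγ : ∀ x κ μ ν, γ x κ μ ν = (β (x + unitVec κ) μ ν - β x μ ν) - (β (x + unitVec μ) κ ν - β x κ ν) + (β (x + unitVec ν) κ μ - β x κ μ))
    (B : Finset (Zd d)) :
    ∑ x ∈ B, ∑ μ, ∑ ν, (ω x μ ν - ∑ κ, (γ (x - unitVec κ) κ μ ν - γ x κ μ ν)) ^ 2
      ≤ (2 + 18 * (d : ℝ) ^ 2) * ∑ y ∈ box p ℓ, ∑ μ, ∑ ν, ω y μ ν ^ 2 := by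
  -- the mixed second differences as a free symbol
  set T : Zd d → Fin d → Fin d → Fin d → Fin d → ℝ :=
    fun x κ a c₁ c₂ => β (x + unitVec a) c₁ c₂ - β x c₁ c₂ - β (x - unitVec κ + unitVec a) c₁ c₂ + β (x - unitVec κ) c₁ c₂ with hTdef
  have hT : ∀ x κ a c₁ c₂, T x κ a c₁ c₂ = β (x + unitVec a) c₁ c₂ - β x c₁ c₂ - β (x - unitVec κ + unitVec a) c₁ c₂ + β (x - unitVec κ) c₁ c₂ :=
    fun _ _ _ _ _ => rfl
  -- pointwise expansion + Cauchy–Schwarz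
  have hpt : ∀ x μ ν, (ω x μ ν - ∑ κ, (γ (x - unitVec κ) κ μ ν - γ x κ μ ν)) ^ 2
      ≤ 2 * ω x μ ν ^ 2 + 6 * (d : ℝ) * ∑ κ, (T x κ κ μ ν ^ 2 + T x κ μ κ ν ^ 2 + T x κ ν κ μ ^ 2) := by
    intro x μ ν
    have hexp : ω x μ ν - ∑ κ, (γ (x - unitVec κ) κ μ ν - γ x κ μ ν) = ω x μ ν + ∑ κ, (T x κ κ μ ν - T x κ μ κ ν + T x κ ν κ μ) := by
      rw [sub_eq_add_neg, ← Finset.sum_neg_distrib]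
      congr 1
      refine Finset.sum_congr rfl fun κ _ => ?_
      rw [dTwo_bdiff_eq β γ T hγ hT x κ μ ν]
      ring
    rw [hexp]
    exact sq_add_sum_three_le (ω x μ ν) (fun κ => T x κ κ μ ν) (fun κ => T x κ μ κ ν) (fun κ => T x κ ν κ μ)
  -- sum over `x ∈ B`, `μ`, `ν`
  have hsum : ∑ x ∈ B, ∑ μ, ∑ ν, (ω x μ ν - ∑ κ, (γ (x - unitVec κ) κ μ ν - γ x κ μ ν)) ^ 2
      ≤ ∑ x ∈ B, ∑ μ, ∑ ν, (2 * ω x μ ν ^ 2 + 6 * (d : ℝ) * ∑ κ, (T x κ κ μ ν ^ 2 + T x κ μ κ ν ^ 2 + T x κ ν κ μ ^ 2)) :=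
    Finset.sum_le_sum fun x _ => Finset.sum_le_sum fun μ _ => Finset.sum_le_sum fun ν _ => hpt x μ ν
  refine hsum.trans ?_
  -- each `T`-family has ℓ² mass ≤ the corresponding component mass of `ω`
  have hTT : ∀ κ a c₁ c₂, ∑ x ∈ B, T x κ a c₁ c₂ ^ 2 ≤ ∑ y ∈ box p ℓ, ω y c₁ c₂ ^ 2 :=
    fun κ a c₁ c₂ => sum_sq_mixedDiff_le hd ω β T p ℓ hβ hT B κ a c₁ c₂
  have hω2 : ∀ μ ν, ∑ x ∈ B, ω x μ ν ^ 2 ≤ ∑ y ∈ box p ℓ, ω y μ ν ^ 2 := fun μ ν => sum_sq_charge_le ω p ℓ hω0 B μ ν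
  -- commuting the site sum inside
  have comm3 : ∀ (g : Zd d → Fin d → Fin d → ℝ) (S : Finset (Zd d)),
      ∑ x ∈ S, ∑ μ, ∑ ν, g x μ ν = ∑ μ, ∑ ν, ∑ x ∈ S, g x μ ν := by
    intro g S
    rw [Finset.sum_comm]
    exact Finset.sum_congr rfl fun μ _ => Finset.sum_comm
  have comm4 : ∀ (g : Zd d → Fin d → Fin d → Fin d → ℝ) (S : Finset (Zd d)),
      ∑ x ∈ S, ∑ μ, ∑ ν, ∑ κ, g x κ μ ν = ∑ μ, ∑ ν, ∑ κ, ∑ x ∈ S, g x κ μ ν := by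
    intro g S
    rw [comm3 (fun x μ ν => ∑ κ, g x κ μ ν) S]
    exact Finset.sum_congr rfl fun μ _ => Finset.sum_congr rfl fun ν _ => Finset.sum_comm
  set W' := ∑ μ : Fin d, ∑ ν : Fin d, ∑ y ∈ box p ℓ, ω y μ ν ^ 2 with hW'
  have hWW : ∑ y ∈ box p ℓ, ∑ μ, ∑ ν, ω y μ ν ^ 2 = W' := comm3 (fun y μ ν => ω y μ ν ^ 2) (box p ℓ)
  rw [hWW]
  -- split the right-hand side of `hsum`
  have e1 : ∑ x ∈ B, ∑ μ, ∑ ν, (2 * ω x μ ν ^ 2 + 6 * (d : ℝ) * ∑ κ, (T x κ κ μ ν ^ 2 + T x κ μ κ ν ^ 2 + T x κ ν κ μ ^ 2))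
      = 2 * (∑ x ∈ B, ∑ μ, ∑ ν, ω x μ ν ^ 2)
        + 6 * (d : ℝ) * ((∑ x ∈ B, ∑ μ, ∑ ν, ∑ κ, T x κ κ μ ν ^ 2) + (∑ x ∈ B, ∑ μ, ∑ ν, ∑ κ, T x κ μ κ ν ^ 2)
            + (∑ x ∈ B, ∑ μ, ∑ ν, ∑ κ, T x κ ν κ μ ^ 2)) := by
    simp only [Finset.sum_add_distrib, Finset.mul_sum, mul_add]
  rw [e1]
  -- the charge term
  have hA : ∑ x ∈ B, ∑ μ, ∑ ν, ω x μ ν ^ 2 ≤ W' := by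
    rw [comm3 (fun x μ ν => ω x μ ν ^ 2) B]
    exact Finset.sum_le_sum fun μ _ => Finset.sum_le_sum fun ν _ => hω2 μ ν
  -- the three `T`-families
  have hB1 : ∑ x ∈ B, ∑ μ, ∑ ν, ∑ κ, T x κ κ μ ν ^ 2 ≤ (d : ℝ) * W' := by
    rw [comm4 (fun x κ μ ν => T x κ κ μ ν ^ 2) B]
    calc ∑ μ : Fin d, ∑ ν : Fin d, ∑ κ : Fin d, ∑ x ∈ B, T x κ κ μ ν ^ 2
        ≤ ∑ μ : Fin d, ∑ ν : Fin d, ∑ _κ : Fin d, ∑ y ∈ box p ℓ, ω y μ ν ^ 2 :=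
          Finset.sum_le_sum fun μ _ => Finset.sum_le_sum fun ν _ => Finset.sum_le_sum fun κ _ => hTT κ κ μ ν
      _ = (d : ℝ) * W' := by
          rw [hW']
          simp only [Finset.sum_const, Finset.card_univ, Fintype.card_fin, nsmul_eq_mul, ← Finset.mul_sum]
  have hB2 : ∑ x ∈ B, ∑ μ, ∑ ν, ∑ κ, T x κ μ κ ν ^ 2 ≤ (d : ℝ) * W' := by
    rw [comm4 (fun x κ μ ν => T x κ μ κ ν ^ 2) B]
    calc ∑ μ : Fin d, ∑ ν : Fin d, ∑ κ : Fin d, ∑ x ∈ B, T x κ μ κ ν ^ 2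
        ≤ ∑ _μ : Fin d, ∑ ν : Fin d, ∑ κ : Fin d, ∑ y ∈ box p ℓ, ω y κ ν ^ 2 :=
          Finset.sum_le_sum fun μ _ => Finset.sum_le_sum fun ν _ => Finset.sum_le_sum fun κ _ => hTT κ μ κ ν
      _ = (d : ℝ) * W' := by
          rw [Finset.sum_const, Finset.card_univ, Fintype.card_fin, nsmul_eq_mul, hW', Finset.sum_comm]
  have hB3 : ∑ x ∈ B, ∑ μ, ∑ ν, ∑ κ, T x κ ν κ μ ^ 2 ≤ (d : ℝ) * W' := by
    rw [comm4 (fun x κ μ ν => T x κ ν κ μ ^ 2) B]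
    calc ∑ μ : Fin d, ∑ ν : Fin d, ∑ κ : Fin d, ∑ x ∈ B, T x κ ν κ μ ^ 2
        ≤ ∑ μ : Fin d, ∑ _ν : Fin d, ∑ κ : Fin d, ∑ y ∈ box p ℓ, ω y κ μ ^ 2 :=
          Finset.sum_le_sum fun μ _ => Finset.sum_le_sum fun ν _ => Finset.sum_le_sum fun κ _ => hTT κ ν κ μ
      _ = (d : ℝ) * W' := by
          simp only [Finset.sum_const, Finset.card_univ, Fintype.card_fin, nsmul_eq_mul]
          rw [← Finset.mul_sum, hW', Finset.sum_comm]
  have hd0 : (0 : ℝ) ≤ d := Nat.cast_nonneg d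
  nlinarith

end Summit.QuantumFields.YangMills.Theorems.CovariantDischargeGreenPotentialL2

end
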